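import Literature.Geometry.Riemannian.GurskyViaclovskyClosednessBootstrapAux
import Literature.Geometry.Riemannian.GurskyViaclovskyClosednessEKOperatorDef
import Literature.Geometry.Riemannian.GurskyViaclovskyClosednessHybridMargin
import Literature.Geometry.Riemannian.GurskyViaclovskyClosednessEKGlue
import Literature.Analysis.PDE.EvansKrylovJets
import HarnessLib

/-!
# Gursky–Viaclovsky closedness: the Evans–Krylov form of the chart equation — top-slot algebra,
# smoothness, vanishing along solutions, `Σ^t` along top-slot lines

Support file (everything PROVED; no definition, no named fact) for the named fact
`Literature.Geometry.Riemannian.gurskyViaclovsky_pathClosed_weighted_four`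
(Gursky–Viaclovsky, J. Differential Geom. 63 (2003), Prop. 6: the interior `C^{2,α}` estimate of
the closedness step is Evans–Krylov's, Gilbarg–Trudinger Thm. 17.14, for the CONCAVE
reformulation `σ₂^{1/2}(A^t_U) = (¼(Qe^{4U} + ¼|W|²))^{1/2}` of the chart equation). The jet
function is `ekOperator G W Q ψ (y, t, J) = ψ(Σ^t(y, pOf J, rOf J)) − ψ(¼(Q e^{4J₀} + ¼W))`
(`GurskyViaclovskyClosednessEKOperatorDef.lean`), `Σ^t = ¼·chartOperator G t 0`. Here, with the
top-slot jets `topJet Ω` of `Literature/Analysis/PDE/EvansKrylovJets.lean`: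

* `rOf_apply_eq_sum`, `rOf_apply_basis`, `rOf_symm_of_apply_symm`, `rOf_congr_two`,
  `pOf_topJet`, `rOf_topJet_symm`, `rOf_add_smul_topJet_symm`,
  `topJet_apply_two`, `topJet_apply_zero`, `add_smul_topJet_apply_zero`, `topJet_frame_symm` —
  how `pOf`, `rOf`, the slots and the frame arrays read a jet moved in the top slot;
* `sigma2Polar_add_smul_left`, `sigma2Polar_add_right` — bilinearity of the polarised `σ₂`;
* `eventually_lt_sigma2_line`, `pos_of_differentiable_sqrt_cutoff`,
  `hasDerivAt_cutoff_sigma2_line` — one-variable calculus of `ψ ∘ σ₂` along a line of arrays for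
  a smooth cutoff `ψ = √` on `[c/2, ∞)` (such a `ψ` forces `c > 0`);
* `contDiffOn_ekOperator` — the jet function is `C^∞` on `{y ∈ U} × ℝ × CJet`;
* `ekOperator_cjetOf_eq_zero` — a solution of `backgroundPathOperator g t (−f) = Q e^{4f}` with
  `W = |W_g|²` solves `ekOperator = 0` at its `2`-jet, for every `ψ`;
* `gvForm_topJet_line`, `chartOperator_zero_topJet_line` — along the top-slot line
  `J + s·topJet Ω` the frame array of `𝒜^t` is `M + sB` and `Σ^t = σ₂(M + sB)`;
* `solution_frame_admissible` — at the jet of an admissible solution of the background equation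
  with `q ≥ q₀ > 0`, `|f| ≤ C`, `t ≤ 1`, `0 < c ≤ q₀e^{−4C}/4`: `D²F(y)` is symmetric and the frame
  array of `𝒜^t` is in `Γ₂⁺` with `σ₂ > c/2` (`le_sigma2Inv_of_equation`,
  `sqrt_le_trace_of_equation`, `gammaTwoPos_frame_of_pos`).

The top-slot derivatives and the two concavity inequalities (hypothesis (ii)' of Thm. 17.14) are
in `GurskyViaclovskyClosednessEKOperator.lean`.

## References

* M. J. Gursky, J. A. Viaclovsky, J. Differential Geom. 63 (2003) 131–154, §2 Def. 2,
  Prop. 1 (iii), Prop. 6. [GurskyViaclovsky2003]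
* D. Gilbarg, N. S. Trudinger, *Elliptic Partial Differential Equations of Second Order* (2001),
  §17.4, (17.43) and Thm. 17.14. [GilbargTrudinger2001]
-/

noncomputable section

set_option maxSynthPendingDepth 3

open scoped Manifold ContDiff Topology
open Set Filter Metric Function Module

namespace Literature.Geometry.Riemannian.GurskyViaclovskyPath

open Literature.Geometry.Lorentzian (PseudoRiemannianMetric)
open Literature.Geometry.Lorentzian.PseudoRiemannianMetric
open Literature.Geometry.Lorentzian
open Literature.Geometry.Lorentzian.MetricCoord
open Literature.Geometry.Riemannian.GurskyViaclovsky
open Literature.Analysis.Calculus Literature.Analysis.PDE.EvansKrylov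

/-! ### How `pOf`, `rOf` and the slots see the top slot -/

section JetAlgebra

variable {ι : Type*} [Fintype ι] {E : Type*} [NormedAddCommGroup E] [InnerProductSpace ℝ E]

/-- `rOf bE J (v, w) = Σ_{ij} J₂(i,j) ⟨e_i, v⟩ ⟨e_j, w⟩`. [folklore] -/
theorem rOf_apply_eq_sum (bE : OrthonormalBasis ι ℝ E) (J : CJet ι 2) (v w : E) :
    rOf bE J v w = ∑ i, ∑ j, J 2 ![i, j] * (inner ℝ (bE i) v * inner ℝ (bE j) w) := by
  simp only [rOf, FunLike.coe_sum, Finset.sum_apply, FunLike.coe_smul, Pi.smul_apply,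
    ContinuousLinearMap.smulRight_apply, innerSL_apply_apply, smul_eq_mul]

/-- `rOf` only reads the top slot of the jet. [folklore] -/
theorem rOf_congr_two (bE : OrthonormalBasis ι ℝ E) {J K : CJet ι 2} (h : J 2 = K 2) :
    rOf bE J = rOf bE K := by
  simp only [rOf, h]

/-- On basis vectors `rOf bE J (e_i, e_j) = J₂(i, j)`. [folklore] -/
theorem rOf_apply_basis (bE : OrthonormalBasis ι ℝ E) (J : CJet ι 2) (i j : ι) :
    rOf bE J (bE i) (bE j) = J 2 ![i, j] := by
  classical
  have hon : ∀ k l, inner ℝ (bE k) (bE l) = if k = l then (1 : ℝ) else 0 :=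
    orthonormal_iff_ite.1 bE.orthonormal
  rw [rOf_apply_eq_sum, Finset.sum_eq_single i, Finset.sum_eq_single j]
  · simp
  · intro l _ hl
    simp [hon, hl]
  · simp
  · intro k _ hk
    exact Finset.sum_eq_zero fun l _ ↦ by simp [hon, hk]
  · simp

/-- `rOf bE J` is a symmetric bilinear form when the top slot of `J` is symmetric. [folklore] -/
theorem rOf_symm_of_apply_symm (bE : OrthonormalBasis ι ℝ E) {J : CJet ι 2}
    (hJ : ∀ i j, J 2 ![i, j] = J 2 ![j, i]) (v w : E) : rOf bE J v w = rOf bE J w v := by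
  rw [rOf_apply_eq_sum, rOf_apply_eq_sum, Finset.sum_comm]
  exact Finset.sum_congr rfl fun i _ ↦ Finset.sum_congr rfl fun j _ ↦ by rw [hJ j i]; ring

omit [Fintype ι] in
/-- The top slot of `topJet Ω`, read at the numeral `2 = Fin.last 2`. [folklore] -/
theorem topJet_apply_two (Ω : (Fin 2 → ι) → ℝ) : (topJet Ω : CJet ι 2) 2 = Ω :=
  topJet_apply_last Ω

omit [Fintype ι] in
/-- The order-zero slot of `topJet Ω` vanishes. [folklore] -/
theorem topJet_apply_zero (Ω : (Fin 2 → ι) → ℝ) : (topJet Ω : CJet ι 2) 0 = 0 :=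
  topJet_apply_of_ne Ω (by decide)

/-- `pOf` does not see the top slot: `pOf (topJet Ω) = 0`. [folklore] -/
theorem pOf_topJet (bE : OrthonormalBasis ι ℝ E) (Ω : (Fin 2 → ι) → ℝ) :
    pOf bE (topJet Ω) = 0 := by
  classical exact pOf_single_last bE Ω

/-- `rOf (topJet Ω)` is symmetric for a symmetric `Ω`. [folklore] -/
theorem rOf_topJet_symm (bE : OrthonormalBasis ι ℝ E) {Ω : (Fin 2 → ι) → ℝ}
    (hΩ : ∀ i j, Ω ![i, j] = Ω ![j, i]) (v w : E) :
    rOf bE (topJet Ω) v w = rOf bE (topJet Ω) w v :=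
  rOf_symm_of_apply_symm bE (fun i j ↦ by rw [topJet_apply_two]; exact hΩ i j) v w

/-- Along a top-slot line through a jet with symmetric `rOf`, in a symmetric direction, `rOf`
stays symmetric. [folklore] -/
theorem rOf_add_smul_topJet_symm (bE : OrthonormalBasis ι ℝ E) {J : CJet ι 2}
    (hJ : ∀ v w, rOf bE J v w = rOf bE J w v) {Ω : (Fin 2 → ι) → ℝ}
    (hΩ : ∀ i j, Ω ![i, j] = Ω ![j, i]) (s : ℝ) (v w : E) :
    rOf bE (J + s • topJet Ω) v w = rOf bE (J + s • topJet Ω) w v := by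
  have hlr := (isBoundedLinearMap_rOf bE).toIsLinearMap
  rw [hlr.map_add, hlr.map_smul]
  have e1 : (rOf bE J + s • rOf bE (topJet Ω)) v w = rOf bE J v w + s * rOf bE (topJet Ω) v w :=
    rfl
  have e2 : (rOf bE J + s • rOf bE (topJet Ω)) w v = rOf bE J w v + s * rOf bE (topJet Ω) w v :=
    rfl
  rw [e1, e2, hJ v w, rOf_topJet_symm bE hΩ v w]

omit [Fintype ι] in
/-- Moving a jet along a top-slot line does not change its order-zero entry. [folklore] -/
theorem add_smul_topJet_apply_zero (J : CJet ι 2) (s : ℝ) (Ω : (Fin 2 → ι) → ℝ) :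
    (J + s • topJet Ω) 0 Fin.elim0 = J 0 Fin.elim0 := by
  have hz : (s • topJet Ω : CJet ι 2) 0 Fin.elim0 = 0 := by
    rw [Pi.smul_apply, topJet_apply_zero, smul_zero]
    rfl
  rw [Pi.add_apply, Pi.add_apply, hz, add_zero]

omit [Fintype ι] in
/-- Moving a jet in the top slot does not change its order-zero entry. [folklore] -/
theorem add_topJet_apply_zero (J : CJet ι 2) (Ω : (Fin 2 → ι) → ℝ) :
    (J + topJet Ω) 0 Fin.elim0 = J 0 Fin.elim0 := by
  have hz : (topJet Ω : CJet ι 2) 0 Fin.elim0 = 0 := by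
    rw [topJet_apply_zero]
    rfl
  rw [Pi.add_apply, Pi.add_apply, hz, add_zero]

end JetAlgebra

/-! ### Bilinearity of the polarised `σ₂` and the cutoff `ψ ∘ σ₂` along a line of arrays -/

section Arrays

/-- `σ₂(M + sB, N) = σ₂(M, N) + s σ₂(B, N)`. [folklore] -/
theorem sigma2Polar_add_smul_left (M B N : Fin 4 → Fin 4 → ℝ) (s : ℝ) :
    sigma2Polar (fun a c ↦ M a c + s * B a c) N = sigma2Polar M N + s * sigma2Polar B N := by
  simp only [sigma2Polar, sigma1, frameInner, Fin.sum_univ_four]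
  ring

/-- `σ₂(M, M + B) = σ₂(M, M) + σ₂(M, B)`. [folklore] -/
theorem sigma2Polar_add_right (M B : Fin 4 → Fin 4 → ℝ) :
    sigma2Polar M (fun a c ↦ M a c + B a c) = sigma2Polar M M + sigma2Polar M B := by
  simp only [sigma2Polar, sigma1, frameInner, Fin.sum_univ_four]
  ring

/-- Along the line `M + sB` the value `σ₂` stays above any level it exceeds at `s = 0`, for `s`
near `0` (continuity of the quadratic polynomial `σ₂(M + sB)`). [folklore] -/
theorem eventually_lt_sigma2_line {M B : Fin 4 → Fin 4 → ℝ} (hM : ∀ a b, M a b = M b a)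
    (hB : ∀ a b, B a b = B b a) {κ : ℝ} (hκ : κ < sigma2 M) :
    ∀ᶠ s in 𝓝 (0 : ℝ), κ < sigma2 (fun a b ↦ M a b + s * B a b) := by
  have hc : ContinuousAt (fun s : ℝ ↦ sigma2 (fun a b ↦ M a b + s * B a b)) 0 :=
    (hasDerivAt_sigma2_line hM hB 0).continuousAt
  refine Filter.Tendsto.eventually_const_lt ?_ hc
  simp only [zero_mul, add_zero]
  exact hκ

/-- **A differentiable cutoff of `√` lives on a positive half-line**: if `ψ` is differentiable and
`ψ(s) = √s` for `s ≥ c/2`, then `c > 0` — otherwise `ψ²` would be differentiable at `0` with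
derivative `2ψ(0)ψ'(0) = 0` and equal to the identity on `[0, ∞)`. [folklore] -/
theorem pos_of_differentiable_sqrt_cutoff {ψ : ℝ → ℝ} {c : ℝ} (hψ : Differentiable ℝ ψ)
    (hψc : ∀ s, c / 2 ≤ s → ψ s = Real.sqrt s) : 0 < c := by
  by_contra hc
  push Not at hc
  have h0 : ∀ s : ℝ, 0 ≤ s → ψ s = Real.sqrt s := fun s hs ↦ hψc s (by linarith)
  have hψ0 : ψ 0 = 0 := by rw [h0 0 le_rfl, Real.sqrt_zero]
  have hg : HasDerivAt (fun s ↦ ψ s * ψ s) (deriv ψ 0 * ψ 0 + ψ 0 * deriv ψ 0) 0 :=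
    (hψ 0).hasDerivAt.mul (hψ 0).hasDerivAt
  rw [hψ0, mul_zero, zero_mul, add_zero] at hg
  have hid : HasDerivWithinAt (fun s ↦ ψ s * ψ s) 1 (Ici 0) 0 := by
    refine (hasDerivWithinAt_id (0 : ℝ) _).congr (fun s hs ↦ ?_) ?_
    · rw [h0 s hs, Real.mul_self_sqrt hs, id]
    · rw [hψ0, mul_zero, id]
  have h := (uniqueDiffOn_Ici (0 : ℝ) 0 self_mem_Ici).eq_deriv _ hg.hasDerivWithinAt hid
  norm_num at h

/-- **The derivative of `ψ ∘ σ₂` along a line of symmetric arrays**: for a cutoff `ψ = √` on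
`[c/2, ∞)` with `c > 0` and `σ₂(M) > c/2`,
`d/ds|₀ (ψ(σ₂(M + sB)) − K) = σ₂(M, B)/σ₂(M)^{1/2}` (`hasDerivAt_sqrt_sigma2_line`; near `s = 0`
the cutoff is not seen). [cite: GilbargTrudinger2001, §17.4, (17.43)] -/
theorem hasDerivAt_cutoff_sigma2_line {M B : Fin 4 → Fin 4 → ℝ} (hM : ∀ a b, M a b = M b a)
    (hB : ∀ a b, B a b = B b a) {ψ : ℝ → ℝ} {c : ℝ} (hc : 0 < c)
    (hψc : ∀ s, c / 2 ≤ s → ψ s = Real.sqrt s) (hcM : c / 2 < sigma2 M) (K : ℝ) :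
    HasDerivAt (fun s : ℝ ↦ ψ (sigma2 (fun a b ↦ M a b + s * B a b)) - K)
      (sigma2Polar M B / Real.sqrt (sigma2 M)) 0 := by
  have h0 : sigma2 (fun a b ↦ M a b + (0 : ℝ) * B a b) = sigma2 M := by
    simp only [zero_mul, add_zero]
  have hM0 : 0 < sigma2 M := by linarith
  have hd : HasDerivAt (fun s : ℝ ↦ Real.sqrt (sigma2 (fun a b ↦ M a b + s * B a b)))
      (sigma2Polar M B / Real.sqrt (sigma2 M)) 0 := by
    have h := hasDerivAt_sqrt_sigma2_line hM hB (s := 0) (by rw [h0]; exact hM0)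
    rw [h0] at h
    simpa using h
  have hd' : HasDerivAt (fun s : ℝ ↦ ψ (sigma2 (fun a b ↦ M a b + s * B a b)))
      (sigma2Polar M B / Real.sqrt (sigma2 M)) 0 := by
    refine hd.congr_of_eventuallyEq ?_
    filter_upwards [eventually_lt_sigma2_line hM hB hcM] with s hs
    exact hψc _ hs.le
  exact hd'.sub_const K

end Arrays

/-! ### The Evans–Krylov jet function on an open subset of `ℝ⁴` -/

section OpensChart

variable {U : TopologicalSpace.Opens (EuclideanSpace ℝ (Fin 4))}
  (g : PseudoRiemannianMetric 𝓘(ℝ, EuclideanSpace ℝ (Fin 4)) ∞ (EuclideanSpace ℝ (Fin 4))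
    (TangentSpace 𝓘(ℝ, EuclideanSpace ℝ (Fin 4)) : U → Type _))
  [g.HasLeviCivita]
  {G : EuclideanSpace ℝ (Fin 4) →
    EuclideanSpace ℝ (Fin 4) →L[ℝ] EuclideanSpace ℝ (Fin 4) →L[ℝ] ℝ}
  (hG : ∀ y : U, g.val y = G y)

omit [g.HasLeviCivita] in
include hG in
/-- The Evans–Krylov jet function is `C^∞` on `{y ∈ U} × ℝ × CJet` when `W`, `Q` are `C^∞` on `U`
and `ψ` is `C^∞` (`contDiffOn_jetOperator` with `W = Q = 0` for `Σ^t`, and `ψ ∘`).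
[cite: GilbargTrudinger2001, §17.4, Thm. 17.14 (hypothesis `F ∈ C²(Γ)`)] -/
theorem contDiffOn_ekOperator {W Q : EuclideanSpace ℝ (Fin 4) → ℝ}
    (hW : ContDiffOn ℝ ∞ W (U : Set (EuclideanSpace ℝ (Fin 4))))
    (hQ : ContDiffOn ℝ ∞ Q (U : Set (EuclideanSpace ℝ (Fin 4)))) {ψ : ℝ → ℝ}
    (hψ : ContDiff ℝ ∞ ψ) :
    ContDiffOn ℝ ∞ (ekOperator G W Q ψ)
      {x | x.1 ∈ (U : Set (EuclideanSpace ℝ (Fin 4)))} := by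
  have hmet : IsMetricOn G (U : Set (EuclideanSpace ℝ (Fin 4))) := OpensChart.isMetricOn_repr hG
  have hπ : ContDiffOn ℝ ∞ (fun x : (EuclideanSpace ℝ (Fin 4)) × ℝ × CJet (Fin 4) 2 ↦ x.1) {x | x.1 ∈ (U : Set (EuclideanSpace ℝ (Fin 4)))} :=
    contDiff_fst.contDiffOn
  have hD : MapsTo (fun x : (EuclideanSpace ℝ (Fin 4)) × ℝ × CJet (Fin 4) 2 ↦ x.1) {x | x.1 ∈ (U : Set (EuclideanSpace ℝ (Fin 4)))} U :=
    fun _ hx ↦ hx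
  have h1 : ContDiffOn ℝ ∞ (fun x : (EuclideanSpace ℝ (Fin 4)) × ℝ × CJet (Fin 4) 2 ↦
      chartOperator G x.2.1 0 x.1 (pOf (EuclideanSpace.basisFun (Fin 4) ℝ) x.2.2) (rOf (EuclideanSpace.basisFun (Fin 4) ℝ) x.2.2)) {x | x.1 ∈ (U : Set (EuclideanSpace ℝ (Fin 4)))} :=
    contDiffOn_chartOperator_comp hmet (w := fun _ ↦ 0) contDiff_snd.fst.contDiffOn
      contDiffOn_const hπ hD
      ((isBoundedLinearMap_pOf (EuclideanSpace.basisFun (Fin 4) ℝ)).contDiff.comp contDiff_snd.snd).contDiffOn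
      ((isBoundedLinearMap_rOf (EuclideanSpace.basisFun (Fin 4) ℝ)).contDiff.comp contDiff_snd.snd).contDiffOn
  have h0 : ContDiff ℝ ∞ (fun J : CJet (Fin 4) 2 ↦ J 0 Fin.elim0) :=
    contDiff_pi.1 (contDiff_pi.1 contDiff_id 0) _
  have h2 : ContDiffOn ℝ ∞ (fun x : (EuclideanSpace ℝ (Fin 4)) × ℝ × CJet (Fin 4) 2 ↦
      (Q x.1 * Real.exp (4 * x.2.2 0 Fin.elim0) + W x.1 / 4) / 4) {x | x.1 ∈ (U : Set (EuclideanSpace ℝ (Fin 4)))} :=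
    (((hQ.comp hπ hD).mul (Real.contDiff_exp.comp (contDiff_const.mul
      (h0.comp contDiff_snd.snd))).contDiffOn).add ((hW.comp hπ hD).div_const 4)).div_const 4
  exact (hψ.comp_contDiffOn (h1.div_const 4)).sub (hψ.comp_contDiffOn h2)

include hG in
/-- **A solution solves the Evans–Krylov jet equation**: if
`backgroundPathOperator g t (−f) y = Q(y) e^{4 f(y)}` and `W(y) = |W_g|²(y)`, then
`ekOperator G W Q ψ (y, t, cjet₂F(y)) = 0` for the representative `F` of `f` — for ANY `ψ`
(`jetOperator_cjetOf_eq_zero`: `chartOperator G t (W y) … = Q e^{4F}`, and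
`chartOperator G t W' = chartOperator G t 0 − W'/4`). [cite: GurskyViaclovsky2003, Prop. 6] -/
theorem ekOperator_cjetOf_eq_zero (hg : g.IsRiemannian) {W Q : EuclideanSpace ℝ (Fin 4) → ℝ}
    (ψ : ℝ → ℝ) (t : ℝ) {f : U → ℝ} (hf : ContMDiff 𝓘(ℝ, EuclideanSpace ℝ (Fin 4)) 𝓘(ℝ) ∞ f)
    {F : EuclideanSpace ℝ (Fin 4) → ℝ} (hfF : ∀ y : U, f y = F y) (y : U)
    (hF : ContDiffAt ℝ 2 F y) (hWy : W y = g.weylNormSq y)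
    (heq : backgroundPathOperator g t (fun z ↦ -f z) y = Q y * Real.exp (-4 * (-f y))) :
    ekOperator G W Q ψ ((y : EuclideanSpace ℝ (Fin 4)), t,
      cjetOf (EuclideanSpace.basisFun (Fin 4) ℝ) 2 F y) = 0 := by
  have h := jetOperator_cjetOf_eq_zero g hG hg (EuclideanSpace.basisFun (Fin 4) ℝ) t hf hfF y hF hWy heq
  rw [chartOperator_eq_zero_sub] at h
  have h4 : chartOperator G t 0 y (pOf (EuclideanSpace.basisFun (Fin 4) ℝ) (cjetOf (EuclideanSpace.basisFun (Fin 4) ℝ) 2 F y)) (rOf (EuclideanSpace.basisFun (Fin 4) ℝ) (cjetOf (EuclideanSpace.basisFun (Fin 4) ℝ) 2 F y)) / 4 =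
      (Q y * Real.exp (4 * cjetOf (EuclideanSpace.basisFun (Fin 4) ℝ) 2 F y 0 Fin.elim0) + W y / 4) / 4 := by
    linarith
  rw [ekOperator_apply, h4, sub_self]

/-- **The frame data along a top-slot line**: for any jet `J`, top-slot direction `Ω` and vectors
`v, w`, `𝒜^t(y, pOf(J + s·topJet Ω), rOf(J + s·topJet Ω))(v, w) = 𝒜^t(y, pOf J, rOf J)(v, w) +
s (ρ(v,w) + ((1−t)/2)(tr_G ρ) G_y(v,w))`, `ρ = rOf(topJet Ω)` (`pOf` ignores the top slot, `rOf`
is linear, `gvForm_add_right`). [cite: GurskyViaclovsky2003, §1 (change1)] -/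
theorem gvForm_topJet_line (t : ℝ) (y : EuclideanSpace ℝ (Fin 4)) (J : CJet (Fin 4) 2)
    (Ω : (Fin 2 → Fin 4) → ℝ) (s : ℝ) (v w : EuclideanSpace ℝ (Fin 4)) :
    gvForm G t y (pOf (EuclideanSpace.basisFun (Fin 4) ℝ) (J + s • topJet Ω)) (rOf (EuclideanSpace.basisFun (Fin 4) ℝ) (J + s • topJet Ω)) v w =
      gvForm G t y (pOf (EuclideanSpace.basisFun (Fin 4) ℝ) J) (rOf (EuclideanSpace.basisFun (Fin 4) ℝ) J) v w +
        s * (rOf (EuclideanSpace.basisFun (Fin 4) ℝ) (topJet Ω) v w + (1 - t) / 2 * mtrAt G y (rOf (EuclideanSpace.basisFun (Fin 4) ℝ) (topJet Ω)) * G y v w) := by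
  have hlp := (isBoundedLinearMap_pOf (EuclideanSpace.basisFun (Fin 4) ℝ)).toIsLinearMap
  have hlr := (isBoundedLinearMap_rOf (EuclideanSpace.basisFun (Fin 4) ℝ)).toIsLinearMap
  have hp : pOf (EuclideanSpace.basisFun (Fin 4) ℝ) (J + s • topJet Ω) = pOf (EuclideanSpace.basisFun (Fin 4) ℝ) J := by
    rw [hlp.map_add, hlp.map_smul, pOf_topJet, smul_zero, add_zero]
  have hr : rOf (EuclideanSpace.basisFun (Fin 4) ℝ) (J + s • topJet Ω) = rOf (EuclideanSpace.basisFun (Fin 4) ℝ) J + s • rOf (EuclideanSpace.basisFun (Fin 4) ℝ) (topJet Ω) := by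
    rw [hlr.map_add, hlr.map_smul]
  have e1 : (s • rOf (EuclideanSpace.basisFun (Fin 4) ℝ) (topJet Ω)) v w = s * rOf (EuclideanSpace.basisFun (Fin 4) ℝ) (topJet Ω) v w := rfl
  rw [hp, hr, gvForm_add_right, mtrAt_smul, e1]
  ring

omit [g.HasLeviCivita] in
include hG in
/-- The variation array `B_{ac} = ρ(b_a,b_c) + ((1−t)/2)(tr_G ρ) G_y(b_a,b_c)`, `ρ = rOf(topJet Ω)`,
of a symmetric top-slot direction `Ω` is symmetric (`G_y` is symmetric). [folklore] -/
theorem topJet_frame_symm (t : ℝ) (y : U) (b : Fin 4 → EuclideanSpace ℝ (Fin 4))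
    {Ω : (Fin 2 → Fin 4) → ℝ} (hΩ : ∀ i j, Ω ![i, j] = Ω ![j, i]) (a c : Fin 4) :
    rOf (EuclideanSpace.basisFun (Fin 4) ℝ) (topJet Ω) (b a) (b c) + (1 - t) / 2 * mtrAt G y (rOf (EuclideanSpace.basisFun (Fin 4) ℝ) (topJet Ω)) * G y (b a) (b c) =
      rOf (EuclideanSpace.basisFun (Fin 4) ℝ) (topJet Ω) (b c) (b a) +
        (1 - t) / 2 * mtrAt G y (rOf (EuclideanSpace.basisFun (Fin 4) ℝ) (topJet Ω)) * G y (b c) (b a) := by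
  rw [rOf_topJet_symm (EuclideanSpace.basisFun (Fin 4) ℝ) hΩ (b a) (b c), (OpensChart.isMetricOn_repr hG).symm y y.2 (b a) (b c)]

include hG in
/-- **`Σ^t` along a top-slot line is `σ₂` along a line of frame arrays**: for a jet `J` with
symmetric `rOf J`, a symmetric top-slot direction `Ω` and a `g_y`-orthonormal frame `b`,
`Σ^t(y, pOf(J + s·topJet Ω), rOf(J + s·topJet Ω)) = σ₂(M + s B)` with
`M_{ac} = 𝒜^t(y,pOf J,rOf J)(b_a,b_c)` and `B_{ac} = ρ(b_a,b_c) + ((1−t)/2)(tr_G ρ) G_y(b_a,b_c)`,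
`ρ = rOf(topJet Ω)` (`pOf` ignores
the top slot, `rOf` is linear, `gvForm_add_right`, `chartOperator_eq_sigma2_frame` with `W = 0`).
[cite: GurskyViaclovsky2003, §2 Def. 2] -/
theorem chartOperator_zero_topJet_line (t : ℝ) (y : U)
    {b : Basis (Fin 4) ℝ (TangentSpace 𝓘(ℝ, EuclideanSpace ℝ (Fin 4)) y)}
    (hb : g.IsOrthonormalFrame y b) {J : CJet (Fin 4) 2}
    (hJ : ∀ v w, rOf (EuclideanSpace.basisFun (Fin 4) ℝ) J v w =
      rOf (EuclideanSpace.basisFun (Fin 4) ℝ) J w v)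
    {Ω : (Fin 2 → Fin 4) → ℝ} (hΩ : ∀ i j, Ω ![i, j] = Ω ![j, i]) (s : ℝ) :
    chartOperator G t 0 y
        (pOf (EuclideanSpace.basisFun (Fin 4) ℝ) (J + s • topJet Ω))
        (rOf (EuclideanSpace.basisFun (Fin 4) ℝ) (J + s • topJet Ω)) / 4 =
      sigma2 (fun a c ↦
        gvForm G t y (pOf (EuclideanSpace.basisFun (Fin 4) ℝ) J)
            (rOf (EuclideanSpace.basisFun (Fin 4) ℝ) J) (b a) (b c) +
          s * (rOf (EuclideanSpace.basisFun (Fin 4) ℝ) (topJet Ω) (b a) (b c) +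
            (1 - t) / 2 * mtrAt G y (rOf (EuclideanSpace.basisFun (Fin 4) ℝ) (topJet Ω)) *
              G y (b a) (b c))) := by
  have harr : (fun a c ↦ gvForm G t y (pOf (EuclideanSpace.basisFun (Fin 4) ℝ) (J + s • topJet Ω)) (rOf (EuclideanSpace.basisFun (Fin 4) ℝ) (J + s • topJet Ω))
      (b a) (b c)) = fun a c ↦ gvForm G t y (pOf (EuclideanSpace.basisFun (Fin 4) ℝ) J) (rOf (EuclideanSpace.basisFun (Fin 4) ℝ) J) (b a) (b c) +
        s * (rOf (EuclideanSpace.basisFun (Fin 4) ℝ) (topJet Ω) (b a) (b c) +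
          (1 - t) / 2 * mtrAt G y (rOf (EuclideanSpace.basisFun (Fin 4) ℝ) (topJet Ω)) * G y (b a) (b c)) := by
    funext a c
    exact gvForm_topJet_line t y J Ω s (b a) (b c)
  rw [chartOperator_eq_sigma2_frame g hG t 0 y hb _ (rOf_add_smul_topJet_symm (EuclideanSpace.basisFun (Fin 4) ℝ) hJ hΩ s), harr]
  ring

/-! ### The jet of an admissible solution -/

include hG in
/-- **The jet of an admissible solution is admissible with margin in every frame**: along a
smooth solution of `backgroundPathOperator g t (−f) = q e^{4f}` with `q ≥ q₀ > 0`, `|f| ≤ C`,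
`t ≤ 1`, `backgroundScalar > 0` and `0 < c ≤ q₀e^{−4C}/4`, at `y`: `D²F(y)` is symmetric, the frame
array `M` of `𝒜^t(y, DF(y), D²F(y))` lies in `Γ₂⁺` and `σ₂(M) > c/2`
(`le_sigma2Inv_of_equation`, `sqrt_le_trace_of_equation`, `gammaTwoPos_frame_of_pos`).
[cite: GurskyViaclovsky2003, Prop. 6 (proof)] -/
theorem solution_frame_admissible (hg : g.IsRiemannian) {c : ℝ} (hc : 0 < c) {f : U → ℝ}
    (hf : ContMDiff 𝓘(ℝ, EuclideanSpace ℝ (Fin 4)) 𝓘(ℝ) ∞ f) {F : EuclideanSpace ℝ (Fin 4) → ℝ}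
    (hfF : ∀ y : U, f y = F y) {q : U → ℝ} {t q₀ C : ℝ} (ht : t ≤ 1) (hq₀ : 0 < q₀)
    (hcq : c ≤ q₀ * Real.exp (-4 * C) / 4) (y : U) (hF : ContDiffAt ℝ 2 F y) (hqy : q₀ ≤ q y)
    (heq : backgroundPathOperator g t (fun z ↦ -f z) y = q y * Real.exp (-4 * (-f y)))
    (hpos : 0 < backgroundScalar g (fun z ↦ -f z) y) (hfy : |f y| ≤ C)
    {b : Basis (Fin 4) ℝ (TangentSpace 𝓘(ℝ, EuclideanSpace ℝ (Fin 4)) y)}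
    (hb : g.IsOrthonormalFrame y b) :
    (∀ v w, fderiv ℝ (fderiv ℝ F) y v w = fderiv ℝ (fderiv ℝ F) y w v) ∧
      GammaTwoPos (fun a c ↦ gvForm G t y (fderiv ℝ F y) (fderiv ℝ (fderiv ℝ F) y)
        (b a) (b c)) ∧
      c / 2 < sigma2 (fun a c ↦ gvForm G t y (fderiv ℝ F y) (fderiv ℝ (fderiv ℝ F) y)
        (b a) (b c)) := by
  have hr : ∀ v w, fderiv ℝ (fderiv ℝ F) y v w = fderiv ℝ (fderiv ℝ F) y w v := fun v w ↦
    (hF.isSymmSndFDerivAt (by simp)).eq v w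
  have hSig := le_sigma2Inv_of_equation g hG hg t hf hfF hq₀ y hF hqy heq hfy
  have hτ := sqrt_le_trace_of_equation g hG hg ht hf hfF hq₀ y hF hqy heq hpos hfy
  have h2c : 0 < Real.sqrt (2 * (q₀ * Real.exp (-4 * C) / 4)) := Real.sqrt_pos.2 (by positivity)
  obtain ⟨hΓ, hσ⟩ := gammaTwoPos_frame_of_pos g hG t y hb (fderiv ℝ F y) hr (by linarith)
    (by linarith)
  exact ⟨hr, hΓ, by rw [hσ]; linarith⟩

end OpensChart

end Literature.Geometry.Riemannian.GurskyViaclovskyPath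

end
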